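import Literature.NumberTheory.LFunctions.TruncatedWeilFormTailOrderDensityProofs
import Literature.Analysis.SpecialFunctions.DigammaGauss
import HarnessLib

/-!
# RH-FREE — «nothing here bears on the truth of RH»: proof of Groskin's explicit tail budget (arXiv:2607.02828, Corollary 3.3 (iii))

PROOF LAYER for `Literature/NumberTheory/LFunctions/TruncatedWeilFormTailOrder.lean` (statement
file, cell `rh-columns/lit`). Discharges the claim `Groskin2026.corollary_3_3_iii`
(A. Groskin, *A finite Guinand–Weil dictionary and archimedean tail order for the truncated Weil
quadratic form*, arXiv:2607.02828v3, Corollary 3.3 (iii) «Explicit budget», p. 11): for `N ≥ 1` and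
`T > max(ρN, 7)` the tail budget
`B_T = (1/π²)∫_T^∞ h₊(r) sin²(Lr/2) ρ⁻¹ (‖p_r‖² + ‖q_r‖²) dr` satisfies

1. `B_T ≤ (2(2N+1)ρ/π²)(log T/(T − ρN) + (ρN)⁻¹ log(T/(T − ρN)))`;
2. `B_T / ((2N+1)ρ/(π²T) · (log(T/2π) + 1)) → 1` as `T → ∞`;
3. `B_{2T}/B_T → ½`.

The proof is the printed one (p. 11): "(iii) For the explicit bound, use `sin² ≤ 1`, the envelope
`h₊(r) ≤ log r` of Lemma 3.1, and `‖p_r‖² + ‖q_r‖² ≤ 2(2N+1)ρ²/(r − ρN)²`, then integrate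
`∫_T^∞ log r/(r − b)² dr = log T/(T − b) + b⁻¹ log(T/(T − b))` (`b = ρN < T`). For the asymptotic
form, `‖p_r‖² + ‖q_r‖² = 2(2N+1)ρ²r⁻²(1 + O(Nρ/r))`, `h₊(r) = log(r/2π) + o(1)`, and the oscillatory
part of `sin² = ½ − ½cos(Lr)` contributes `O(T⁻² log T)` after one integration by parts; the
remaining smooth integral is `½∫_T^∞ log(r/2π) 2(2N+1)ρ r⁻² dr = (2N+1)ρ(log(T/2π) + 1)/T` up to the
stated relative error."

Inputs consumed BY NAME: the envelope `hPlus_le_log_sub` (`h₊(t) ≤ log t − 8/5`, `t ≥ 7`) and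
`hPlus_pos_of_seven_le` from cc-t6's `TruncatedWeilFormTailOrderDensityProofs.lean` / the statement
file; `h₊(r) = log(r/2π) + O(1/r)` is derived here from the tree's
`Literature.Analysis.SpecialFunctions.Complex.abs_re_digamma_sub_log_norm_le`
(`|Re ψ(w) − log ‖w‖| ≤ 1/(2‖w‖²) + π/(4|Im w|)`).

No new definitions, no named facts; nothing here bears on the truth of RH.
-/

noncomputable section

open Filter Set MeasureTheory Finset Matrix
open scoped Real Topology

namespace Literature.NumberTheory.LFunctions

namespace Groskin2026

open Literature.Analysis.SpecialFunctions

/-! ### §1 The finite objects `ρ`, `I_N`, `‖p_r‖² + ‖q_r‖²` -/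

/-- `ρ = 2π/log c > 0` for `c > 1` (private copy; the public one is cc-t18's, in
`TruncatedWeilFormTailMinorsProofs.lean`). [cite: Groskin2026, §2.1 (p. 3)] -/
private theorem rhoPos_aux {c : ℝ} (hc : 1 < c) : 0 < rho c :=
  div_pos (by positivity) (Real.log_pos hc)

/-- `|I_N| = 2N + 1`. [cite: Groskin2026, §2.1 (p. 3)] -/
theorem card_idx (N : ℕ) : Fintype.card (idx N) = 2 * N + 1 := by
  rw [Fintype.card_coe, idx, Int.card_Icc]
  omega

/-- `|n| ≤ N` for `n ∈ I_N`, as reals. [cite: Groskin2026, §2.1 (p. 3)] -/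
theorem abs_intCast_le_of_idx {N : ℕ} (n : idx N) : |((n : ℤ) : ℝ)| ≤ N := by
  have h := n.2
  simp only [idx, Finset.mem_Icc] at h
  rw [abs_le]
  constructor
  · exact_mod_cast h.1
  · exact_mod_cast h.2

/-- `‖p_r‖² + ‖q_r‖² = Σ_{n ∈ I_N} (1/(a_r − n)² + 1/(a_r + n)²)`. [cite: Groskin2026, §3 (p. 8)] -/
theorem pq_normSq_eq_sum (c : ℝ) (N : ℕ) (r : ℝ) :
    pVec c N r ⬝ᵥ pVec c N r + qVec c N r ⬝ᵥ qVec c N r =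
      ∑ n : idx N, (1 / (aCut c r - ((n : ℤ) : ℝ)) ^ 2 + 1 / (aCut c r + ((n : ℤ) : ℝ)) ^ 2) := by
  simp only [dotProduct, pVec, qVec, ← Finset.sum_add_distrib]
  refine Finset.sum_congr rfl fun n _ ↦ ?_
  rw [div_mul_div_comm, one_mul, ← pow_two, div_mul_div_comm, one_mul, ← pow_two]

/-- `‖p_r‖² + ‖q_r‖² ≥ 0`. [cite: Groskin2026, §3 (p. 8)] -/
theorem pq_normSq_nonneg (c : ℝ) (N : ℕ) (r : ℝ) :
    0 ≤ pVec c N r ⬝ᵥ pVec c N r + qVec c N r ⬝ᵥ qVec c N r := by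
  rw [pq_normSq_eq_sum]
  exact Finset.sum_nonneg fun n _ ↦ by positivity

/-- **The crude bound** `‖p_r‖² + ‖q_r‖² ≤ 2(2N+1)ρ²/(r − ρN)²` for `r > ρN` (proof of Cor. 3.3 (iii)).
[cite: Groskin2026, Corollary 3.3 (iii), proof (p. 11)] -/
theorem pq_normSq_le {c : ℝ} (hc : 1 < c) (N : ℕ) {r : ℝ} (hr : rho c * N < r) :
    pVec c N r ⬝ᵥ pVec c N r + qVec c N r ⬝ᵥ qVec c N r ≤
      2 * (2 * N + 1) * rho c ^ 2 / (r - rho c * N) ^ 2 := by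
  have hρ := rhoPos_aux hc
  set a := aCut c r with ha
  have haN : (N : ℝ) < a := by
    rw [ha, aCut, lt_div_iff₀ hρ]; linarith
  have hterm : ∀ n : idx N,
      1 / (a - ((n : ℤ) : ℝ)) ^ 2 + 1 / (a + ((n : ℤ) : ℝ)) ^ 2 ≤ 2 * (1 / (a - N) ^ 2) := by
    intro n
    have hn := abs_le.1 (abs_intCast_le_of_idx n)
    have h1 : 0 < a - N := by linarith
    have h2 : a - N ≤ a - ((n : ℤ) : ℝ) := by linarith [hn.2]
    have h3 : a - N ≤ a + ((n : ℤ) : ℝ) := by linarith [hn.1]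
    have e1 : 1 / (a - ((n : ℤ) : ℝ)) ^ 2 ≤ 1 / (a - N) ^ 2 := by
      apply one_div_le_one_div_of_le (by positivity)
      exact pow_le_pow_left₀ h1.le h2 2
    have e2 : 1 / (a + ((n : ℤ) : ℝ)) ^ 2 ≤ 1 / (a - N) ^ 2 := by
      apply one_div_le_one_div_of_le (by positivity)
      exact pow_le_pow_left₀ h1.le h3 2
    linarith
  rw [pq_normSq_eq_sum]
  calc ∑ n : idx N, (1 / (a - ((n : ℤ) : ℝ)) ^ 2 + 1 / (a + ((n : ℤ) : ℝ)) ^ 2)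
      ≤ ∑ _n : idx N, 2 * (1 / (a - N) ^ 2) := Finset.sum_le_sum fun n _ ↦ hterm n
    _ = (2 * N + 1) * (2 * (1 / (a - N) ^ 2)) := by
        rw [Finset.sum_const, Finset.card_univ, card_idx, nsmul_eq_mul]
        push_cast
        ring
    _ = 2 * (2 * N + 1) * rho c ^ 2 / (r - rho c * N) ^ 2 := by
        have hsub : a - N = (r - rho c * N) / rho c := by
          rw [ha, aCut]; field_simp
        rw [hsub]
        have hne : r - rho c * N ≠ 0 := by linarith
        field_simp

/-- One Cauchy term against its asymptote: `|1/(a − n)² − 1/a²| ≤ 10N/a³` for `|n| ≤ N`, `2N ≤ a`,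
`a > 0`. [cite: Groskin2026, Corollary 3.3 (iii), proof (p. 11): "`‖p_r‖² + ‖q_r‖² = 2(2N+1)ρ²r⁻²(1 + O(Nρ/r))`"] -/
theorem abs_inv_sq_sub_le {a n : ℝ} {N : ℕ} (hn : |n| ≤ N) (ha : 2 * (N : ℝ) ≤ a) (ha0 : 0 < a) :
    |1 / (a - n) ^ 2 - 1 / a ^ 2| ≤ 10 * N / a ^ 3 := by
  have hn' := abs_le.1 hn
  have hN : (0 : ℝ) ≤ N := Nat.cast_nonneg N
  have han : 0 < a - n := by linarith [hn'.2]
  have h1 : 1 / (a - n) ^ 2 - 1 / a ^ 2 = n * (2 * a - n) / (a ^ 2 * (a - n) ^ 2) := by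
    field_simp
    ring
  rw [h1, abs_div, abs_mul, abs_of_pos (by positivity : 0 < a ^ 2 * (a - n) ^ 2)]
  have h2 : |2 * a - n| ≤ 5 / 2 * a := by
    rw [abs_le]; constructor <;> linarith [hn'.1, hn'.2]
  have h3 : a ^ 2 / 4 ≤ (a - n) ^ 2 := by nlinarith [hn'.1, hn'.2]
  calc |n| * |2 * a - n| / (a ^ 2 * (a - n) ^ 2)
      ≤ N * (5 / 2 * a) / (a ^ 2 * (a ^ 2 / 4)) := by
        gcongr
    _ = 10 * N / a ^ 3 := by
        field_simp
        ring

/-- **The asymptote of `‖p_r‖² + ‖q_r‖²`**: for `r ≥ 2ρN`,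
`|‖p_r‖² + ‖q_r‖² − 2(2N+1)ρ²/r²| ≤ 20N(2N+1)ρ³/r³`.
[cite: Groskin2026, Corollary 3.3 (iii), proof (p. 11)] -/
theorem abs_pq_normSq_sub_le {c : ℝ} (hc : 1 < c) (N : ℕ) {r : ℝ} (hr0 : 0 < r)
    (hr : 2 * rho c * N ≤ r) :
    |pVec c N r ⬝ᵥ pVec c N r + qVec c N r ⬝ᵥ qVec c N r - 2 * (2 * N + 1) * rho c ^ 2 / r ^ 2| ≤
      20 * N * (2 * N + 1) * rho c ^ 3 / r ^ 3 := by
  have hρ := rhoPos_aux hc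
  set a := aCut c r with ha
  have ha0 : 0 < a := by rw [ha, aCut]; positivity
  have haN : 2 * (N : ℝ) ≤ a := by
    rw [ha, aCut, le_div_iff₀ hρ]; linarith
  have hra : rho c ^ 2 / r ^ 2 = 1 / a ^ 2 := by
    rw [ha, aCut]; field_simp
  have hra3 : rho c ^ 3 / r ^ 3 = 1 / a ^ 3 := by
    rw [ha, aCut]; field_simp
  have hterm : ∀ n : idx N,
      |1 / (a - ((n : ℤ) : ℝ)) ^ 2 + 1 / (a + ((n : ℤ) : ℝ)) ^ 2 - 2 * (1 / a ^ 2)| ≤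
        2 * (10 * N / a ^ 3) := by
    intro n
    have hn := abs_intCast_le_of_idx n
    have hn' : |(-((n : ℤ) : ℝ))| ≤ N := by rwa [abs_neg]
    have e1 := abs_inv_sq_sub_le hn haN ha0
    have e2 := abs_inv_sq_sub_le hn' haN ha0
    rw [sub_neg_eq_add] at e2
    calc _ = |(1 / (a - ((n : ℤ) : ℝ)) ^ 2 - 1 / a ^ 2) + (1 / (a + ((n : ℤ) : ℝ)) ^ 2 - 1 / a ^ 2)| := by
          ring_nf
      _ ≤ |1 / (a - ((n : ℤ) : ℝ)) ^ 2 - 1 / a ^ 2| + |1 / (a + ((n : ℤ) : ℝ)) ^ 2 - 1 / a ^ 2| :=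
          abs_add_le _ _
      _ ≤ 10 * N / a ^ 3 + 10 * N / a ^ 3 := add_le_add e1 e2
      _ = 2 * (10 * N / a ^ 3) := by ring
  rw [pq_normSq_eq_sum, mul_div_assoc, hra, mul_div_assoc, hra3]
  have hsum : (2 * (2 * (N : ℝ) + 1)) * (1 / a ^ 2) =
      ∑ _n : idx N, 2 * (1 / a ^ 2) := by
    rw [Finset.sum_const, Finset.card_univ, card_idx, nsmul_eq_mul]; push_cast; ring
  rw [hsum, ← Finset.sum_sub_distrib]
  calc _ ≤ ∑ n : idx N, |1 / (a - ((n : ℤ) : ℝ)) ^ 2 + 1 / (a + ((n : ℤ) : ℝ)) ^ 2 - 2 * (1 / a ^ 2)| :=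
        Finset.abs_sum_le_sum_abs _ _
    _ ≤ ∑ _n : idx N, 2 * (10 * N / a ^ 3) := Finset.sum_le_sum fun n _ ↦ hterm n
    _ = 20 * N * (2 * N + 1) * (1 / a ^ 3) := by
        rw [Finset.sum_const, Finset.card_univ, card_idx, nsmul_eq_mul]; push_cast; ring

/-- `‖p_r‖² + ‖q_r‖²` is continuous on `r > ρN` (no Cauchy pole there).
[cite: Groskin2026, §3 (p. 8)] -/
theorem continuousOn_pq_normSq {c : ℝ} (hc : 1 < c) (N : ℕ) :
    ContinuousOn (fun r : ℝ ↦ pVec c N r ⬝ᵥ pVec c N r + qVec c N r ⬝ᵥ qVec c N r)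
      (Ioi (rho c * N)) := by
  have hρ := rhoPos_aux hc
  simp only [pq_normSq_eq_sum]
  refine continuousOn_finsetSum _ fun n _ ↦ ?_
  have hn := abs_le.1 (abs_intCast_le_of_idx n)
  have hne : ∀ r ∈ Ioi (rho c * N), aCut c r - ((n : ℤ) : ℝ) ≠ 0 ∧ aCut c r + ((n : ℤ) : ℝ) ≠ 0 := by
    intro r hr
    have haN : (N : ℝ) < aCut c r := by
      rw [aCut, lt_div_iff₀ hρ]; linarith [mem_Ioi.1 hr]
    constructor <;> · intro h; linarith [hn.1, hn.2]
  have hac : Continuous fun r : ℝ ↦ aCut c r := by unfold aCut; fun_prop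
  refine ContinuousOn.add ?_ ?_
  · refine ContinuousOn.div continuousOn_const (by fun_prop) fun r hr ↦ ?_
    exact pow_ne_zero 2 (hne r hr).1
  · refine ContinuousOn.div continuousOn_const (by fun_prop) fun r hr ↦ ?_
    exact pow_ne_zero 2 (hne r hr).2

/-! ### §2 The archimedean density: continuity, envelope, asymptote -/

/-- `h₊` is continuous (private copy; the public one is cc-t18's, in
`TruncatedWeilFormTailMinorsProofs.lean`). [cite: Groskin2026, §2.1 (p. 4)] -/
private theorem continuous_hPlus_aux : Continuous hPlus :=
  continuous_reDigammaQuarter.sub continuous_const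

/-- **The envelope** `0 ≤ h₊(r) ≤ log r` for `r ≥ 7` (Lemma 3.1, via cc-t6's `hPlus_le_log_sub` and the
statement file's `hPlus_pos_of_seven_le`). [cite: Groskin2026, Lemma 3.1 (p. 9)] -/
theorem hPlus_mem_Icc {r : ℝ} (hr : 7 ≤ r) : hPlus r ∈ Icc 0 (Real.log r) :=
  ⟨(hPlus_pos_of_seven_le hr).le, by linarith [hPlus_le_log_sub hr]⟩

/-- **The asymptote** `|h₊(r) − log(r/2π)| ≤ 3/r` for `r ≥ 7`, from the tree's
`|Re ψ(w) − log ‖w‖| ≤ 1/(2‖w‖²) + π/(4|Im w|)` at `w = ¼ + ir/2` ("`h₊(r) = log(r/2π) + o(1)`").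
[cite: Groskin2026, Corollary 3.3 (iii), proof (p. 11)] -/
theorem abs_hPlus_sub_log_le {r : ℝ} (hr : 7 ≤ r) :
    |hPlus r - Real.log (r / (2 * π))| ≤ 3 / r := by
  have hr0 : 0 < r := by linarith
  set w : ℂ := 1 / 4 + r / 2 * Complex.I with hw
  have hwre : w.re = 1 / 4 := by simp [hw]
  have hwim : w.im = r / 2 := by simp [hw]
  have hw2 : ‖w‖ ^ 2 = 1 / 16 + r ^ 2 / 4 := by
    rw [Complex.sq_norm, Complex.normSq_apply, hwre, hwim]; ring
  have hwne : w ≠ 0 := fun h ↦ by rw [h, Complex.zero_re] at hwre; norm_num at hwre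
  have hwpos : 0 < ‖w‖ := norm_pos_iff.2 hwne
  have hψ := Complex.abs_re_digamma_sub_log_norm_le (w := w) (by rw [hwre]; norm_num)
    (by rw [hwim]; positivity)
  rw [hwim] at hψ
  -- `hPlus r = Re ψ(w) − log π`
  have hh : hPlus r = (Complex.digamma w).re - Real.log π := by
    simp [hPlus, reDigammaQuarter, hw]
  -- `|log ‖w‖ − log (r/2)| ≤ 1/(8 r²)`
  have hlogw : |Real.log ‖w‖ - Real.log (r / 2)| ≤ 1 / (8 * r ^ 2) := by
    have hge : r / 2 ≤ ‖w‖ := by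
      nlinarith [norm_nonneg w, hw2]
    have hq : Real.log ‖w‖ - Real.log (r / 2) = Real.log (‖w‖ / (r / 2)) := by
      rw [Real.log_div hwpos.ne' (by positivity)]
    rw [hq, abs_of_nonneg (Real.log_nonneg (by rw [le_div_iff₀ (by positivity)]; linarith))]
    have h1 : Real.log (‖w‖ / (r / 2)) ≤ ‖w‖ / (r / 2) - 1 :=
      Real.log_le_sub_one_of_pos (by positivity)
    have h2 : ‖w‖ / (r / 2) - 1 ≤ 1 / (8 * r ^ 2) := by
      rw [div_sub_one (by positivity), div_le_div_iff₀ (by positivity) (by positivity)]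
      -- `(‖w‖ − r/2)(‖w‖ + r/2) = 1/16`
      have h3 : (‖w‖ - r / 2) * (‖w‖ + r / 2) = 1 / 16 := by nlinarith [hw2]
      nlinarith [hge, norm_nonneg w]
    linarith
  -- the digamma error
  have hA : 1 / (2 * ‖w‖ ^ 2) + π / (4 * |r / 2|) ≤ 2 / r := by
    rw [abs_of_pos (by positivity), hw2]
    have hπ : π < 3.15 := Real.pi_lt_d2
    have h1 : 1 / (2 * (1 / 16 + r ^ 2 / 4)) ≤ 2 / (7 * r) := by
      rw [div_le_div_iff₀ (by positivity) (by positivity)]; nlinarith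
    have h2 : π / (4 * (r / 2)) ≤ 1.6 / r := by
      rw [div_le_div_iff₀ (by positivity) (by positivity)]; nlinarith
    have h3 : 2 / (7 * r) + 1.6 / r ≤ 2 / r := by
      rw [div_add_div _ _ (by positivity) (by positivity), div_le_div_iff₀ (by positivity) (by positivity)]
      nlinarith
    linarith
  have hlog2π : Real.log (r / (2 * π)) = Real.log (r / 2) - Real.log π := by
    rw [Real.log_div hr0.ne' (by positivity), Real.log_div hr0.ne' (by norm_num),
      Real.log_mul (by norm_num) Real.pi_ne_zero]
    ring
  rw [hh, hlog2π]
  calc |(Complex.digamma w).re - Real.log π - (Real.log (r / 2) - Real.log π)|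
      = |((Complex.digamma w).re - Real.log ‖w‖) + (Real.log ‖w‖ - Real.log (r / 2))| := by ring_nf
    _ ≤ |(Complex.digamma w).re - Real.log ‖w‖| + |Real.log ‖w‖ - Real.log (r / 2)| := abs_add_le _ _
    _ ≤ 2 / r + 1 / (8 * r ^ 2) := add_le_add (hψ.trans hA) hlogw
    _ ≤ 3 / r := by
        rw [div_add_div _ _ (by positivity) (by positivity), div_le_div_iff₀ (by positivity) (by positivity)]
        nlinarith

/-! ### §3 Elementary tail integrals on `(T, ∞)` -/

/-- `d/dr log(r/κ) = 1/r` (`κ, r > 0`). [folklore] -/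
private theorem hasDerivAt_log_div {κ r : ℝ} (hκ : 0 < κ) (hr : 0 < r) :
    HasDerivAt (fun x : ℝ ↦ Real.log (x / κ)) (1 / r) r :=
  (((hasDerivAt_id' r).div_const κ).log (by positivity : r / κ ≠ 0)).congr_deriv
    (by field_simp)

/-- `log(r/κ)/r → 0`. [folklore] -/
private theorem tendsto_log_div_div_atTop {κ : ℝ} (hκ : 0 < κ) :
    Tendsto (fun r : ℝ ↦ Real.log (r / κ) / r) atTop (𝓝 0) := by
  have h1 : Tendsto (fun r : ℝ ↦ Real.log r / r) atTop (𝓝 0) :=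
    Real.isLittleO_log_id_atTop.tendsto_div_nhds_zero
  have h2 : Tendsto (fun r : ℝ ↦ Real.log κ / r) atTop (𝓝 0) :=
    (tendsto_const_nhds (x := Real.log κ)).div_atTop tendsto_id
  have h3 := h1.sub h2
  rw [sub_zero] at h3
  refine h3.congr' ?_
  filter_upwards [eventually_gt_atTop 0] with r hr
  rw [Real.log_div hr.ne' hκ.ne', sub_div]

/-- `(log(r/κ) + 1)/r → 0`. [folklore] -/
private theorem tendsto_log_div_add_one_div_atTop {κ : ℝ} (hκ : 0 < κ) :
    Tendsto (fun r : ℝ ↦ (Real.log (r / κ) + 1) / r) atTop (𝓝 0) := by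
  have h := (tendsto_log_div_div_atTop hκ).add
    ((tendsto_const_nhds (x := (1:ℝ))).div_atTop tendsto_id)
  rw [add_zero] at h
  refine h.congr' (Eventually.of_forall fun r ↦ ?_)
  simp only [id, add_div]

/-- **`∫_T^∞ log(r/κ) r⁻² dr = (log(T/κ) + 1)/T`** for `0 < κ ≤ T` (the "remaining smooth integral"
of the proof of Cor. 3.3 (iii)), with integrability. [cite: Groskin2026, Corollary 3.3 (iii), proof (p. 11)] -/
theorem integral_Ioi_log_div_sq {κ T : ℝ} (hκ : 0 < κ) (hT : κ ≤ T) :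
    IntegrableOn (fun r : ℝ ↦ Real.log (r / κ) / r ^ 2) (Ioi T) ∧
      ∫ r in Ioi T, Real.log (r / κ) / r ^ 2 = (Real.log (T / κ) + 1) / T := by
  have hT0 : 0 < T := lt_of_lt_of_le hκ hT
  have hderiv : ∀ r ∈ Ici T, HasDerivAt (fun x : ℝ ↦ -((Real.log (x / κ) + 1) / x))
      (Real.log (r / κ) / r ^ 2) r := by
    intro r hr
    have hr0 : 0 < r := lt_of_lt_of_le hT0 hr
    have h1 := ((hasDerivAt_log_div hκ hr0).add_const 1).fun_div (hasDerivAt_id' r) hr0.ne'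
    refine h1.fun_neg.congr_deriv ?_
    field_simp
    ring
  have hnonneg : ∀ r ∈ Ioi T, 0 ≤ Real.log (r / κ) / r ^ 2 := by
    intro r hr
    have hr' : κ ≤ r := hT.trans (le_of_lt hr)
    exact div_nonneg (Real.log_nonneg (by rw [le_div_iff₀ hκ]; linarith)) (by positivity)
  have hlim : Tendsto (fun x : ℝ ↦ -((Real.log (x / κ) + 1) / x)) atTop (𝓝 0) := by
    simpa using (tendsto_log_div_add_one_div_atTop hκ).neg
  refine ⟨integrableOn_Ioi_deriv_of_nonneg' hderiv hnonneg hlim, ?_⟩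
  rw [integral_Ioi_of_hasDerivAt_of_nonneg' hderiv hnonneg hlim]
  ring

/-- **`∫_T^∞ (1 + 2log(r/κ)) r⁻³ dr = (1 + log(T/κ))/T²`** for `0 < κ ≤ T` (the integrable majorant of
all error terms), with integrability. [cite: Groskin2026, Corollary 3.3 (iii), proof (p. 11)] -/
theorem integral_Ioi_one_add_two_log_div_cube {κ T : ℝ} (hκ : 0 < κ) (hT : κ ≤ T) :
    IntegrableOn (fun r : ℝ ↦ (1 + 2 * Real.log (r / κ)) / r ^ 3) (Ioi T) ∧
      ∫ r in Ioi T, (1 + 2 * Real.log (r / κ)) / r ^ 3 = (1 + Real.log (T / κ)) / T ^ 2 := by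
  have hT0 : 0 < T := lt_of_lt_of_le hκ hT
  have hderiv : ∀ r ∈ Ici T, HasDerivAt (fun x : ℝ ↦ -((1 + Real.log (x / κ)) / x ^ 2))
      ((1 + 2 * Real.log (r / κ)) / r ^ 3) r := by
    intro r hr
    have hr0 : 0 < r := lt_of_lt_of_le hT0 hr
    have h1 := ((hasDerivAt_log_div hκ hr0).const_add 1).fun_div (hasDerivAt_pow 2 r)
      (by positivity)
    refine h1.fun_neg.congr_deriv ?_
    norm_num
    field_simp
    ring
  have hnonneg : ∀ r ∈ Ioi T, 0 ≤ (1 + 2 * Real.log (r / κ)) / r ^ 3 := by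
    intro r hr
    have hr' : κ ≤ r := hT.trans (le_of_lt hr)
    have hr0 : 0 < r := lt_of_lt_of_le hκ hr'
    have := Real.log_nonneg (by rw [le_div_iff₀ hκ]; linarith : 1 ≤ r / κ)
    positivity
  have hlim : Tendsto (fun x : ℝ ↦ -((1 + Real.log (x / κ)) / x ^ 2)) atTop (𝓝 0) := by
    have h1 := (tendsto_log_div_add_one_div_atTop hκ).mul
      ((tendsto_const_nhds (x := (1:ℝ))).div_atTop tendsto_id)
    rw [mul_zero] at h1
    have h2 : Tendsto (fun x : ℝ ↦ (1 + Real.log (x / κ)) / x ^ 2) atTop (𝓝 0) := by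
      refine h1.congr' ?_
      filter_upwards [eventually_gt_atTop 0] with x hx
      simp only [id]
      field_simp
      ring
    simpa using h2.neg
  refine ⟨integrableOn_Ioi_deriv_of_nonneg' hderiv hnonneg hlim, ?_⟩
  rw [integral_Ioi_of_hasDerivAt_of_nonneg' hderiv hnonneg hlim]
  ring

/-- **`∫_T^∞ log r/(r − b)² dr = log T/(T − b) + b⁻¹ log(T/(T − b))`** for `0 < b < T`, `1 ≤ T`,
with integrability (the explicit integral of the proof of Cor. 3.3 (iii)).
[cite: Groskin2026, Corollary 3.3 (iii), proof (p. 11)] -/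
theorem integral_Ioi_log_div_sub_sq {b T : ℝ} (hb : 0 < b) (hbT : b < T) (hT : 1 ≤ T) :
    IntegrableOn (fun r : ℝ ↦ Real.log r / (r - b) ^ 2) (Ioi T) ∧
      ∫ r in Ioi T, Real.log r / (r - b) ^ 2 =
        Real.log T / (T - b) + b⁻¹ * Real.log (T / (T - b)) := by
  have hT0 : 0 < T := by linarith
  set F : ℝ → ℝ := fun x ↦ -(Real.log x / (x - b)) + b⁻¹ * (Real.log (x - b) - Real.log x) with hF
  have hderiv : ∀ r ∈ Ici T, HasDerivAt F (Real.log r / (r - b) ^ 2) r := by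
    intro r hr
    have hr0 : 0 < r := lt_of_lt_of_le hT0 hr
    have hrb : 0 < r - b := by linarith [mem_Ici.1 hr]
    have h1 := (Real.hasDerivAt_log hr0.ne').fun_div ((hasDerivAt_id' r).sub_const b) hrb.ne'
    have h2 := (((hasDerivAt_id' r).sub_const b).log hrb.ne').fun_sub (Real.hasDerivAt_log hr0.ne')
    have h3 := h1.fun_neg.fun_add (h2.const_mul b⁻¹)
    refine h3.congr_deriv ?_
    field_simp
    ring
  have hnonneg : ∀ r ∈ Ioi T, 0 ≤ Real.log r / (r - b) ^ 2 := by
    intro r hr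
    exact div_nonneg (Real.log_nonneg (hT.trans (le_of_lt hr))) (by positivity)
  have hlim : Tendsto F atTop (𝓝 0) := by
    -- `log r/(r − b) → 0`
    have hA : Tendsto (fun x : ℝ ↦ Real.log x / (x - b)) atTop (𝓝 0) := by
      have h1 : Tendsto (fun x : ℝ ↦ Real.log x / x) atTop (𝓝 0) :=
        Real.isLittleO_log_id_atTop.tendsto_div_nhds_zero
      have h2 : Tendsto (fun x : ℝ ↦ (x - b) / x) atTop (𝓝 1) := by
        have := (tendsto_const_nhds (x := (1:ℝ))).sub
          ((tendsto_const_nhds (x := b)).div_atTop tendsto_id)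
        rw [sub_zero] at this
        refine this.congr' ?_
        filter_upwards [eventually_gt_atTop 0] with x hx
        simp only [id]
        field_simp
      have h3 := h1.mul (h2.inv₀ one_ne_zero)
      rw [inv_one, zero_mul] at h3
      refine h3.congr' ?_
      filter_upwards [eventually_gt_atTop b, eventually_gt_atTop 0] with x hxb hx0
      have : x - b ≠ 0 := by linarith
      field_simp
    -- `log(r − b) − log r → 0`
    have hB : Tendsto (fun x : ℝ ↦ Real.log (x - b) - Real.log x) atTop (𝓝 0) := by
      have h1 : Tendsto (fun x : ℝ ↦ 1 - b / x) atTop (𝓝 1) := by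
        have := (tendsto_const_nhds (x := (1:ℝ))).sub
          ((tendsto_const_nhds (x := b)).div_atTop tendsto_id)
        simpa using this
      have h2 := ((Real.continuousAt_log one_ne_zero).tendsto.comp h1)
      rw [Real.log_one] at h2
      refine h2.congr' ?_
      filter_upwards [eventually_gt_atTop b, eventually_gt_atTop 0] with x hxb hx0
      have hxb' : 0 < x - b := by linarith
      simp only [Function.comp_apply]
      rw [← Real.log_div hxb'.ne' hx0.ne']
      congr 1
      field_simp
    have := hA.neg.add (hB.const_mul b⁻¹)
    simpa [hF] using this
  refine ⟨integrableOn_Ioi_deriv_of_nonneg' hderiv hnonneg hlim, ?_⟩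
  rw [integral_Ioi_of_hasDerivAt_of_nonneg' hderiv hnonneg hlim, hF]
  simp only
  have hTb : 0 < T - b := by linarith
  rw [Real.log_div hT0.ne' hTb.ne']
  ring

/-- **The oscillatory term after one integration by parts**: for `0 < κ ≤ T`, `L > 0`,
`|∫_T^∞ log(r/κ) r⁻² cos(Lr) dr| ≤ L⁻¹ (log(T/κ)/T² + (1 + log(T/κ))/T²)`, with integrability.
[cite: Groskin2026, Corollary 3.3 (iii), proof (p. 11): "the oscillatory part of `sin² = ½ − ½cos(Lr)`
contributes `O(T⁻² log T)` after one integration by parts"] -/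
theorem abs_integral_Ioi_log_div_sq_mul_cos_le {κ L T : ℝ} (hκ : 0 < κ) (hL : 0 < L) (hT : κ ≤ T) :
    IntegrableOn (fun r : ℝ ↦ Real.log (r / κ) / r ^ 2 * Real.cos (L * r)) (Ioi T) ∧
      |∫ r in Ioi T, Real.log (r / κ) / r ^ 2 * Real.cos (L * r)| ≤
        (1 / L) * (Real.log (T / κ) / T ^ 2 + (1 + Real.log (T / κ)) / T ^ 2) := by
  have hT0 : 0 < T := lt_of_lt_of_le hκ hT
  have hlogT : 0 ≤ Real.log (T / κ) := Real.log_nonneg (by rw [le_div_iff₀ hκ]; linarith)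
  obtain ⟨hintA, hvalA⟩ := integral_Ioi_log_div_sq hκ hT
  obtain ⟨hintB, hvalB⟩ := integral_Ioi_one_add_two_log_div_cube hκ hT
  -- `u = log(r/κ)/r²`, `v = sin(Lr)/L`
  set u : ℝ → ℝ := fun r ↦ Real.log (r / κ) / r ^ 2 with hu
  set u' : ℝ → ℝ := fun r ↦ (1 - 2 * Real.log (r / κ)) / r ^ 3 with hu'
  set v : ℝ → ℝ := fun r ↦ Real.sin (L * r) / L with hv
  set v' : ℝ → ℝ := fun r ↦ Real.cos (L * r) with hv'
  have hdu : ∀ r ∈ Ioi T, HasDerivAt u (u' r) r := by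
    intro r hr
    have hr0 : 0 < r := hT0.trans hr
    have h1 := (hasDerivAt_log_div hκ hr0).fun_div (hasDerivAt_pow 2 r) (by positivity)
    refine h1.congr_deriv ?_
    simp only [hu']
    norm_num
    field_simp
  have hdv : ∀ r ∈ Ioi T, HasDerivAt v (v' r) r := by
    intro r _
    have h1 := ((Real.hasDerivAt_sin (L * r)).comp r ((hasDerivAt_id' r).const_mul L)).div_const L
    refine h1.congr_deriv ?_
    simp only [hv']
    field_simp
  have hcontu : ContinuousOn u (Ioi T) := by
    refine ContinuousOn.div ?_ (by fun_prop) fun r hr ↦ by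
      have := hT0.trans hr; positivity
    exact ContinuousOn.log (by fun_prop) fun r hr ↦ by have := hT0.trans hr; positivity
  have hcontu' : ContinuousOn u' (Ioi T) := by
    refine ContinuousOn.div ?_ (by fun_prop) fun r hr ↦ by
      have := hT0.trans hr; positivity
    refine continuousOn_const.sub (ContinuousOn.mul continuousOn_const ?_)
    exact ContinuousOn.log (by fun_prop) fun r hr ↦ by have := hT0.trans hr; positivity
  -- integrability of `u v'` and `u' v`
  have huv' : IntegrableOn (u * v') (Ioi T) := by
    refine Integrable.mono' hintA ?_ ?_
    · exact ((hcontu.mul (by fun_prop : Continuous v').continuousOn)).aestronglyMeasurable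
        measurableSet_Ioi
    · refine ae_restrict_of_forall_mem measurableSet_Ioi fun r hr ↦ ?_
      have hr' : κ ≤ r := hT.trans (le_of_lt hr)
      have hlog : 0 ≤ Real.log (r / κ) := Real.log_nonneg (by rw [le_div_iff₀ hκ]; linarith)
      simp only [Pi.mul_apply, hu, hv', norm_mul, Real.norm_eq_abs]
      rw [abs_of_nonneg (by positivity)]
      calc Real.log (r / κ) / r ^ 2 * |Real.cos (L * r)|
          ≤ Real.log (r / κ) / r ^ 2 * 1 := by gcongr; exact Real.abs_cos_le_one _
        _ = Real.log (r / κ) / r ^ 2 := mul_one _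
  have hu'v : IntegrableOn (u' * v) (Ioi T) := by
    refine Integrable.mono' (hintB.const_mul (1 / L)) ?_ ?_
    · exact ((hcontu'.mul (by fun_prop : Continuous v).continuousOn)).aestronglyMeasurable
        measurableSet_Ioi
    · refine ae_restrict_of_forall_mem measurableSet_Ioi fun r hr ↦ ?_
      have hr' : κ ≤ r := hT.trans (le_of_lt hr)
      have hr0 : 0 < r := hT0.trans hr
      have hlog : 0 ≤ Real.log (r / κ) := Real.log_nonneg (by rw [le_div_iff₀ hκ]; linarith)
      simp only [Pi.mul_apply, hu', hv, norm_mul, Real.norm_eq_abs]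
      rw [abs_div, abs_div, abs_of_pos (by positivity : (0:ℝ) < r ^ 3), abs_of_pos hL]
      have h1 : |1 - 2 * Real.log (r / κ)| ≤ 1 + 2 * Real.log (r / κ) := by
        rw [abs_le]; constructor <;> linarith
      have h2 : |Real.sin (L * r)| ≤ 1 := Real.abs_sin_le_one _
      calc |1 - 2 * Real.log (r / κ)| / r ^ 3 * (|Real.sin (L * r)| / L)
          ≤ (1 + 2 * Real.log (r / κ)) / r ^ 3 * (1 / L) := by gcongr
        _ = 1 / L * ((1 + 2 * Real.log (r / κ)) / r ^ 3) := by ring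
  -- boundary behaviour
  have h_zero : Tendsto (u * v) (𝓝[>] T) (𝓝 (u T * v T)) := by
    have hcu : ContinuousAt u T := by
      refine ContinuousAt.div ?_ (by fun_prop) (by positivity)
      exact ContinuousAt.log (by fun_prop) (by positivity)
    have hcv : ContinuousAt v T := (by fun_prop : Continuous v).continuousAt
    exact ((hcu.mul hcv).tendsto).mono_left nhdsWithin_le_nhds
  have h_infty : Tendsto (u * v) atTop (𝓝 0) := by
    have h1 := tendsto_log_div_div_atTop hκ
    have h2 : Tendsto (fun r : ℝ ↦ |Real.log (r / κ) / r| * (1 / (L * κ))) atTop (𝓝 0) := by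
      simpa using (h1.abs.mul_const (1 / (L * κ)))
    refine squeeze_zero_norm' ?_ h2
    filter_upwards [eventually_ge_atTop T] with r hr
    have hr' : κ ≤ r := hT.trans hr
    have hr0 : 0 < r := lt_of_lt_of_le hκ hr'
    simp only [Pi.mul_apply, hu, hv, norm_mul, Real.norm_eq_abs]
    rw [abs_div (Real.sin _), abs_of_pos hL]
    have h3 : |Real.log (r / κ) / r ^ 2| = |Real.log (r / κ) / r| * (1 / r) := by
      rw [abs_div, abs_div, abs_of_pos (by positivity : (0:ℝ) < r ^ 2), abs_of_pos hr0]
      field_simp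
    rw [h3, mul_assoc]
    refine mul_le_mul_of_nonneg_left ?_ (abs_nonneg _)
    calc 1 / r * (|Real.sin (L * r)| / L) ≤ 1 / κ * (1 / L) := by
          gcongr
          · exact Real.abs_sin_le_one _
      _ = 1 / (L * κ) := by field_simp
  have hibp := integral_Ioi_mul_deriv_eq_deriv_mul hdu hdv huv' hu'v h_zero h_infty
  refine ⟨by simpa only [Pi.mul_def] using huv', ?_⟩
  have hibp' : ∫ r in Ioi T, Real.log (r / κ) / r ^ 2 * Real.cos (L * r) =
      0 - u T * v T - ∫ r in Ioi T, u' r * v r := hibp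
  rw [hibp']
  -- bound the two terms
  have hb1 : |u T * v T| ≤ 1 / L * (Real.log (T / κ) / T ^ 2) := by
    simp only [hu, hv]
    rw [abs_mul, abs_div (Real.sin _), abs_of_pos hL, abs_of_nonneg (by positivity)]
    calc Real.log (T / κ) / T ^ 2 * (|Real.sin (L * T)| / L)
        ≤ Real.log (T / κ) / T ^ 2 * (1 / L) := by gcongr; exact Real.abs_sin_le_one _
      _ = 1 / L * (Real.log (T / κ) / T ^ 2) := by ring
  have hb2 : |∫ r in Ioi T, u' r * v r| ≤ 1 / L * ((1 + Real.log (T / κ)) / T ^ 2) := by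
    rw [← hvalB, ← integral_const_mul, ← Real.norm_eq_abs]
    refine norm_integral_le_of_norm_le (hintB.const_mul (1 / L)) ?_
    refine ae_restrict_of_forall_mem measurableSet_Ioi fun r hr ↦ ?_
    have hr' : κ ≤ r := hT.trans (le_of_lt hr)
    have hr0 : 0 < r := hT0.trans hr
    have hlog : 0 ≤ Real.log (r / κ) := Real.log_nonneg (by rw [le_div_iff₀ hκ]; linarith)
    simp only [hu', hv, norm_mul, Real.norm_eq_abs]
    rw [abs_div, abs_div, abs_of_pos (by positivity : (0:ℝ) < r ^ 3), abs_of_pos hL]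
    have h1 : |1 - 2 * Real.log (r / κ)| ≤ 1 + 2 * Real.log (r / κ) := by
      rw [abs_le]; constructor <;> linarith
    calc |1 - 2 * Real.log (r / κ)| / r ^ 3 * (|Real.sin (L * r)| / L)
        ≤ (1 + 2 * Real.log (r / κ)) / r ^ 3 * (1 / L) := by
          gcongr; exact Real.abs_sin_le_one _
      _ = 1 / L * ((1 + 2 * Real.log (r / κ)) / r ^ 3) := by ring
  calc |0 - u T * v T - ∫ r in Ioi T, u' r * v r|
      = |-(u T * v T) + -(∫ r in Ioi T, u' r * v r)| := by ring_nf
    _ ≤ |-(u T * v T)| + |-(∫ r in Ioi T, u' r * v r)| := abs_add_le _ _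
    _ ≤ 1 / L * (Real.log (T / κ) / T ^ 2) + 1 / L * ((1 + Real.log (T / κ)) / T ^ 2) := by
        rw [abs_neg, abs_neg]; exact add_le_add hb1 hb2
    _ = 1 / L * (Real.log (T / κ) / T ^ 2 + (1 + Real.log (T / κ)) / T ^ 2) := by ring

/-! ### §4 The tail integrand: envelope and integrability; clause (iii)-1 -/

/-- **Envelope of the tail integrand** (proof of Cor. 3.3 (iii): `sin² ≤ 1`, `h₊ ≤ log`,
`‖p_r‖² + ‖q_r‖² ≤ 2(2N+1)ρ²/(r − ρN)²`): for `r ≥ 7`, `r > ρN`,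
`0 ≤ h₊(r) sin²(Lr/2) ρ⁻¹ (‖p_r‖² + ‖q_r‖²) ≤ 2(2N+1)ρ · log r/(r − ρN)²`.
[cite: Groskin2026, Corollary 3.3 (iii), proof (p. 11)] -/
theorem tailIntegrand_mem_Icc {c : ℝ} (hc : 1 < c) (N : ℕ) {r : ℝ} (hr7 : 7 ≤ r)
    (hrN : rho c * N < r) :
    hPlus r * Real.sin (Real.log c * r / 2) ^ 2 / rho c *
        (pVec c N r ⬝ᵥ pVec c N r + qVec c N r ⬝ᵥ qVec c N r) ∈
      Set.Icc 0 (2 * (2 * N + 1) * rho c * (Real.log r / (r - rho c * N) ^ 2)) := by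
  have hρ := rhoPos_aux hc
  obtain ⟨h0, hlog⟩ := hPlus_mem_Icc hr7
  have hs0 : 0 ≤ Real.sin (Real.log c * r / 2) ^ 2 := sq_nonneg _
  have hs1 : Real.sin (Real.log c * r / 2) ^ 2 ≤ 1 := Real.sin_sq_le_one _
  have hS0 := pq_normSq_nonneg c N r
  have hS1 := pq_normSq_le hc N hrN
  have hlog0 : 0 ≤ Real.log r := Real.log_nonneg (by linarith)
  have h1 : hPlus r * Real.sin (Real.log c * r / 2) ^ 2 ≤ Real.log r :=
    (mul_le_of_le_one_right h0 hs1).trans hlog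
  have h2 : hPlus r * Real.sin (Real.log c * r / 2) ^ 2 / rho c ≤ Real.log r / rho c :=
    div_le_div_of_nonneg_right h1 hρ.le
  refine ⟨mul_nonneg (div_nonneg (mul_nonneg h0 hs0) hρ.le) hS0, ?_⟩
  calc hPlus r * Real.sin (Real.log c * r / 2) ^ 2 / rho c *
        (pVec c N r ⬝ᵥ pVec c N r + qVec c N r ⬝ᵥ qVec c N r)
      ≤ Real.log r / rho c * (2 * (2 * N + 1) * rho c ^ 2 / (r - rho c * N) ^ 2) :=
        mul_le_mul h2 hS1 hS0 (div_nonneg hlog0 hρ.le)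
    _ = 2 * (2 * N + 1) * rho c * (Real.log r / (r - rho c * N) ^ 2) := by
        field_simp

/-- The tail integrand is continuous on `r > ρN`. [cite: Groskin2026, §3 (p. 8)] -/
theorem continuousOn_tailIntegrand {c : ℝ} (hc : 1 < c) (N : ℕ) :
    ContinuousOn (fun r : ℝ ↦ hPlus r * Real.sin (Real.log c * r / 2) ^ 2 / rho c *
        (pVec c N r ⬝ᵥ pVec c N r + qVec c N r ⬝ᵥ qVec c N r)) (Ioi (rho c * N)) := by
  have h1 : Continuous fun r : ℝ ↦ hPlus r * Real.sin (Real.log c * r / 2) ^ 2 / rho c :=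
    (continuous_hPlus_aux.mul (by fun_prop)).div_const _
  exact h1.continuousOn.mul (continuousOn_pq_normSq hc N)

/-- **The tail integrand is integrable on `(T, ∞)`** for `N ≥ 1`, `T > ρN`, `T ≥ 7` ("the improper
integral converges … because `p_r(n), q_r(n) = O(r⁻¹)` … while `h₊(r) = O(log r)`").
[cite: Groskin2026, Corollary 3.3 (i)/(iii), proof (p. 11)] -/
theorem integrableOn_tailIntegrand {c : ℝ} (hc : 1 < c) {N : ℕ} (hN : 1 ≤ N) {T : ℝ}
    (hTN : rho c * N < T) (hT7 : 7 ≤ T) :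
    IntegrableOn (fun r : ℝ ↦ hPlus r * Real.sin (Real.log c * r / 2) ^ 2 / rho c *
        (pVec c N r ⬝ᵥ pVec c N r + qVec c N r ⬝ᵥ qVec c N r)) (Ioi T) := by
  have hρ := rhoPos_aux hc
  have hb : 0 < rho c * N := mul_pos hρ ((Nat.cast_pos (α := ℝ)).2 hN)
  obtain ⟨hint, -⟩ := integral_Ioi_log_div_sub_sq hb hTN (by linarith)
  refine Integrable.mono' (hint.const_mul (2 * (2 * N + 1) * rho c)) ?_ ?_
  · exact ((continuousOn_tailIntegrand hc N).mono (Ioi_subset_Ioi hTN.le)).aestronglyMeasurable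
      measurableSet_Ioi
  · refine ae_restrict_of_forall_mem measurableSet_Ioi fun r hr ↦ ?_
    have h := tailIntegrand_mem_Icc hc N (hT7.trans (le_of_lt hr)) (hTN.trans hr)
    rw [Real.norm_eq_abs, abs_of_nonneg h.1]
    exact h.2

/-- **[Gr26] Corollary 3.3 (iii), first clause (explicit budget), PROVED**: for `N ≥ 1` and
`T > max(ρN, 7)`, `B_T ≤ (2(2N+1)ρ/π²)(log T/(T − ρN) + (ρN)⁻¹ log(T/(T − ρN)))`.
[cite: Groskin2026, Corollary 3.3 (iii) (p. 11)] -/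
theorem tailBudget_le {c : ℝ} (hc : 1 < c) {N : ℕ} (hN : 1 ≤ N) {T : ℝ}
    (hT : max (rho c * N) 7 < T) :
    tailBudget c N T ≤
      2 * (2 * N + 1) * rho c / π ^ 2 *
        (Real.log T / (T - rho c * N) + (rho c * N)⁻¹ * Real.log (T / (T - rho c * N))) := by
  have hρ := rhoPos_aux hc
  have hTN : rho c * N < T := lt_of_le_of_lt (le_max_left _ _) hT
  have hT7 : 7 < T := lt_of_le_of_lt (le_max_right _ _) hT
  have hb : 0 < rho c * N := mul_pos hρ ((Nat.cast_pos (α := ℝ)).2 hN)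
  obtain ⟨hint, hval⟩ := integral_Ioi_log_div_sub_sq hb hTN (by linarith)
  have hmono : ∫ r in Ioi T, hPlus r * Real.sin (Real.log c * r / 2) ^ 2 / rho c *
        (pVec c N r ⬝ᵥ pVec c N r + qVec c N r ⬝ᵥ qVec c N r) ≤
      ∫ r in Ioi T, 2 * (2 * N + 1) * rho c * (Real.log r / (r - rho c * N) ^ 2) := by
    refine integral_mono_of_nonneg ?_ (hint.const_mul _) ?_
    · filter_upwards [ae_restrict_mem measurableSet_Ioi] with r hr
      exact (tailIntegrand_mem_Icc hc N (hT7.le.trans (le_of_lt hr)) (hTN.trans hr)).1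
    · filter_upwards [ae_restrict_mem measurableSet_Ioi] with r hr
      exact (tailIntegrand_mem_Icc hc N (hT7.le.trans (le_of_lt hr)) (hTN.trans hr)).2
  rw [integral_const_mul, hval] at hmono
  unfold tailBudget
  calc 1 / π ^ 2 * ∫ r in Ioi T, hPlus r * Real.sin (Real.log c * r / 2) ^ 2 / rho c *
          (pVec c N r ⬝ᵥ pVec c N r + qVec c N r ⬝ᵥ qVec c N r)
      ≤ 1 / π ^ 2 * (2 * (2 * N + 1) * rho c *
          (Real.log T / (T - rho c * N) + (rho c * N)⁻¹ * Real.log (T / (T - rho c * N)))) :=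
        mul_le_mul_of_nonneg_left hmono (by positivity)
    _ = _ := by ring

/-! ### §5 The asymptotic form: clauses (iii)-2 and (iii)-3 -/

/-- `2π < 7`. [folklore] -/
private theorem two_pi_lt_seven : 2 * π < 7 := by
  have := Real.pi_lt_d2; linarith

/-- **Pointwise expansion of the tail integrand** (proof of Cor. 3.3 (iii): `h₊(r) = log(r/2π) + o(1)`,
`‖p_r‖² + ‖q_r‖² = 2(2N+1)ρ²r⁻²(1 + O(Nρ/r))`, `sin² = ½ − ½cos(Lr)`): for `r ≥ 7`, `r ≥ 2ρN`,
`|f(r) − (2N+1)ρ (log(r/2π)/r²)(1 − cos(Lr))| ≤ C (1 + 2log(r/2π))/r³` with an explicit `C = C(c, N)`.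
[cite: Groskin2026, Corollary 3.3 (iii), proof (p. 11)] -/
theorem abs_tailIntegrand_sub_main_le {c : ℝ} (hc : 1 < c) (N : ℕ) :
    ∃ C : ℝ, 0 ≤ C ∧ ∀ r : ℝ, 7 ≤ r → 2 * rho c * N ≤ r →
      |hPlus r * Real.sin (Real.log c * r / 2) ^ 2 / rho c *
            (pVec c N r ⬝ᵥ pVec c N r + qVec c N r ⬝ᵥ qVec c N r) -
          ((2 * N + 1) * rho c * (Real.log (r / (2 * π)) / r ^ 2) -
            (2 * N + 1) * rho c * (Real.log (r / (2 * π)) / r ^ 2 * Real.cos (Real.log c * r)))| ≤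
        C * ((1 + 2 * Real.log (r / (2 * π))) / r ^ 3) := by
  have hρ := rhoPos_aux hc
  set D : ℝ := 20 * N * (2 * N + 1) * rho c ^ 3 with hD
  have hD0 : 0 ≤ D := by positivity
  refine ⟨6 * (2 * N + 1) * rho c + 3 * D / (7 * rho c) + D / (2 * rho c), by positivity, ?_⟩
  intro r hr7 hrN
  have hr0 : 0 < r := by linarith
  set h := hPlus r with hh
  set ℓ := Real.log (r / (2 * π)) with hℓ
  set s2 := Real.sin (Real.log c * r / 2) ^ 2 with hs2
  set S := pVec c N r ⬝ᵥ pVec c N r + qVec c N r ⬝ᵥ qVec c N r with hS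
  set A := 2 * (2 * N + 1) * rho c ^ 2 / r ^ 2 with hA
  have hℓ0 : 0 ≤ ℓ := by
    refine Real.log_nonneg ?_
    rw [le_div_iff₀ (by positivity)]
    linarith [two_pi_lt_seven]
  have hs2_0 : 0 ≤ s2 := sq_nonneg _
  have hs2_1 : s2 ≤ 1 := Real.sin_sq_le_one _
  have hcos : s2 = 1 / 2 - Real.cos (Real.log c * r) / 2 := by
    have hh := Real.sin_sq_eq_half_sub (Real.log c * r / 2)
    rw [show 2 * (Real.log c * r / 2) = Real.log c * r by ring] at hh
    exact hh
  have he1 : |h - ℓ| ≤ 3 / r := abs_hPlus_sub_log_le hr7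
  have he2 : |S - A| ≤ D / r ^ 3 := abs_pq_normSq_sub_le hc N hr0 hrN
  have hA0 : 0 ≤ A := by positivity
  have hSabs : |S| ≤ A + D / r ^ 3 := by
    calc |S| = |A + (S - A)| := by ring_nf
      _ ≤ |A| + |S - A| := abs_add_le _ _
      _ ≤ A + D / r ^ 3 := by rw [abs_of_nonneg hA0]; linarith
  -- the identity: integrand − main part = (s2/ρ)(hS − ℓA)
  have hid : h * s2 / rho c * S -
      ((2 * N + 1) * rho c * (ℓ / r ^ 2) - (2 * N + 1) * rho c * (ℓ / r ^ 2 * Real.cos (Real.log c * r))) =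
      s2 / rho c * (h * S - ℓ * A) := by
    rw [hcos, hA]; field_simp
  rw [hid, abs_mul, abs_of_nonneg (div_nonneg hs2_0 hρ.le)]
  have hkey : |h * S - ℓ * A| ≤ 3 / r * (A + D / r ^ 3) + ℓ * (D / r ^ 3) := by
    calc |h * S - ℓ * A| = |(h - ℓ) * S + ℓ * (S - A)| := by ring_nf
      _ ≤ |(h - ℓ) * S| + |ℓ * (S - A)| := abs_add_le _ _
      _ = |h - ℓ| * |S| + ℓ * |S - A| := by rw [abs_mul, abs_mul, abs_of_nonneg hℓ0]
      _ ≤ 3 / r * (A + D / r ^ 3) + ℓ * (D / r ^ 3) := by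
          gcongr
  have hstep : s2 / rho c * |h * S - ℓ * A| ≤
      1 / rho c * (3 / r * (A + D / r ^ 3) + ℓ * (D / r ^ 3)) := by
    gcongr
  refine hstep.trans ?_
  -- `(1/ρ)(3/r (A + D/r³) + ℓ D/r³) = 6(2N+1)ρ/r³ + (3D/ρ)/r⁴ + (D/ρ) ℓ/r³ ≤ C (1+2ℓ)/r³`
  have hexp : 1 / rho c * (3 / r * (A + D / r ^ 3) + ℓ * (D / r ^ 3)) =
      6 * (2 * N + 1) * rho c * (1 / r ^ 3) + 3 * D / (7 * rho c) * (7 / r ^ 4) +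
        D / (2 * rho c) * (2 * ℓ / r ^ 3) := by
    rw [hA]; field_simp; ring
  rw [hexp]
  have hq : 0 ≤ (1 + 2 * ℓ) / r ^ 3 := by positivity
  have i1 : (1 : ℝ) / r ^ 3 ≤ (1 + 2 * ℓ) / r ^ 3 :=
    div_le_div_of_nonneg_right (by linarith) (by positivity)
  have i2 : (7 : ℝ) / r ^ 4 ≤ (1 + 2 * ℓ) / r ^ 3 := by
    calc (7 : ℝ) / r ^ 4 ≤ 1 / r ^ 3 := by
          rw [div_le_div_iff₀ (by positivity) (by positivity)]
          nlinarith [pow_pos hr0 3]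
      _ ≤ (1 + 2 * ℓ) / r ^ 3 := i1
  have i3 : 2 * ℓ / r ^ 3 ≤ (1 + 2 * ℓ) / r ^ 3 :=
    div_le_div_of_nonneg_right (by linarith) (by positivity)
  have c1 : 0 ≤ 6 * (2 * (N : ℝ) + 1) * rho c := by positivity
  have c2 : 0 ≤ 3 * D / (7 * rho c) := by positivity
  have c3 : 0 ≤ D / (2 * rho c) := by positivity
  calc 6 * (2 * N + 1) * rho c * (1 / r ^ 3) + 3 * D / (7 * rho c) * (7 / r ^ 4) +
        D / (2 * rho c) * (2 * ℓ / r ^ 3)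
      ≤ 6 * (2 * N + 1) * rho c * ((1 + 2 * ℓ) / r ^ 3) +
          3 * D / (7 * rho c) * ((1 + 2 * ℓ) / r ^ 3) +
          D / (2 * rho c) * ((1 + 2 * ℓ) / r ^ 3) := by
        gcongr
    _ = (6 * (2 * N + 1) * rho c + 3 * D / (7 * rho c) + D / (2 * rho c)) *
          ((1 + 2 * ℓ) / r ^ 3) := by ring

/-- **The remainder estimate**: for `N ≥ 1` there is `C` with
`|π² B_T − (2N+1)ρ (log(T/2π) + 1)/T| ≤ C (1 + log(T/2π))/T²` for all `T ≥ max(7, 2ρN)`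
(main smooth integral exact, oscillatory part by one integration by parts, errors `O(T⁻² log T)`).
[cite: Groskin2026, Corollary 3.3 (iii), proof (p. 11)] -/
theorem abs_tailBudget_sub_main_le {c : ℝ} (hc : 1 < c) {N : ℕ} (hN : 1 ≤ N) :
    ∃ C : ℝ, ∀ T : ℝ, 7 ≤ T → 2 * rho c * N ≤ T →
      |π ^ 2 * tailBudget c N T - (2 * N + 1) * rho c * ((Real.log (T / (2 * π)) + 1) / T)| ≤
        C * ((1 + Real.log (T / (2 * π))) / T ^ 2) := by
  have hρ := rhoPos_aux hc
  have hL : 0 < Real.log c := Real.log_pos hc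
  have hκ : 0 < 2 * π := by positivity
  obtain ⟨CE, hCE0, hE⟩ := abs_tailIntegrand_sub_main_le hc N
  set K : ℝ := (2 * N + 1) * rho c with hK
  have hK0 : 0 ≤ K := by positivity
  refine ⟨K * (2 / Real.log c) + CE, fun T hT7 hTN2 ↦ ?_⟩
  have hT0 : 0 < T := by linarith
  have hTκ : 2 * π ≤ T := by linarith [two_pi_lt_seven]
  have hNpos : (0 : ℝ) < N := (Nat.cast_pos (α := ℝ)).2 hN
  have hTN : rho c * N < T := by nlinarith
  have hℓT : 0 ≤ Real.log (T / (2 * π)) :=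
    Real.log_nonneg (by rw [le_div_iff₀ hκ]; linarith)
  -- the four integrable pieces on `(T, ∞)`
  set f : ℝ → ℝ := fun r ↦ hPlus r * Real.sin (Real.log c * r / 2) ^ 2 / rho c *
    (pVec c N r ⬝ᵥ pVec c N r + qVec c N r ⬝ᵥ qVec c N r) with hf
  set mA : ℝ → ℝ := fun r ↦ K * (Real.log (r / (2 * π)) / r ^ 2) with hmA
  set mB : ℝ → ℝ := fun r ↦ K * (Real.log (r / (2 * π)) / r ^ 2 * Real.cos (Real.log c * r))
    with hmB
  set g : ℝ → ℝ := fun r ↦ CE * ((1 + 2 * Real.log (r / (2 * π))) / r ^ 3) with hg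
  have hfi : IntegrableOn f (Ioi T) := integrableOn_tailIntegrand hc hN hTN hT7
  obtain ⟨hAi, hAv⟩ := integral_Ioi_log_div_sq hκ hTκ
  obtain ⟨hBi, hBv⟩ := abs_integral_Ioi_log_div_sq_mul_cos_le hκ hL hTκ
  obtain ⟨hgi, hgv⟩ := integral_Ioi_one_add_two_log_div_cube hκ hTκ
  have hmAi : IntegrableOn mA (Ioi T) := hAi.const_mul K
  have hmBi : IntegrableOn mB (Ioi T) := hBi.const_mul K
  have hgi' : IntegrableOn g (Ioi T) := hgi.const_mul CE
  -- `π² B_T = ∫ f`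
  have hB : π ^ 2 * tailBudget c N T = ∫ r in Ioi T, f r := by
    rw [tailBudget, hf]
    field_simp
  -- `∫ mA = K (log(T/2π) + 1)/T`
  have hmAv : ∫ r in Ioi T, mA r = K * ((Real.log (T / (2 * π)) + 1) / T) := by
    rw [hmA]
    simp only
    rw [integral_const_mul, hAv]
  -- `|∫ mB| ≤ K L⁻¹ (…)`
  have hmBv : |∫ r in Ioi T, mB r| ≤
      K * (1 / Real.log c * (Real.log (T / (2 * π)) / T ^ 2 +
        (1 + Real.log (T / (2 * π))) / T ^ 2)) := by
    rw [hmB]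
    simp only
    rw [integral_const_mul, abs_mul, abs_of_nonneg hK0]
    exact mul_le_mul_of_nonneg_left hBv hK0
  -- `|∫ (f − (mA − mB))| ≤ ∫ g = CE (1 + log(T/2π))/T²`
  have hEv : |∫ r in Ioi T, (f r - (mA r - mB r))| ≤
      CE * ((1 + Real.log (T / (2 * π))) / T ^ 2) := by
    have h1 : ‖∫ r in Ioi T, (f r - (mA r - mB r))‖ ≤ ∫ r in Ioi T, g r := by
      refine norm_integral_le_of_norm_le hgi' ?_
      refine ae_restrict_of_forall_mem measurableSet_Ioi fun r hr ↦ ?_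
      have hr7 : 7 ≤ r := hT7.trans (le_of_lt hr)
      have hrN : 2 * rho c * N ≤ r := hTN2.trans (le_of_lt hr)
      rw [Real.norm_eq_abs]
      have := hE r hr7 hrN
      simpa only [hf, hmA, hmB, hg, hK] using this
    rw [hg] at h1
    simp only at h1
    rw [integral_const_mul, hgv] at h1
    rwa [Real.norm_eq_abs] at h1
  -- assemble
  have hsplit : (∫ r in Ioi T, f r) - K * ((Real.log (T / (2 * π)) + 1) / T) =
      (∫ r in Ioi T, (f r - (mA r - mB r))) - ∫ r in Ioi T, mB r := by
    have h1 := integral_sub hfi (hmAi.sub hmBi)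
    have h2 := integral_sub hmAi hmBi
    simp only [Pi.sub_apply] at h1
    rw [h1, h2, hmAv]
    ring
  rw [hB, hsplit]
  have hℓle : Real.log (T / (2 * π)) / T ^ 2 ≤ (1 + Real.log (T / (2 * π))) / T ^ 2 :=
    div_le_div_of_nonneg_right (by linarith) (by positivity)
  calc |(∫ r in Ioi T, (f r - (mA r - mB r))) - ∫ r in Ioi T, mB r|
      ≤ |∫ r in Ioi T, (f r - (mA r - mB r))| + |∫ r in Ioi T, mB r| := abs_sub _ _
    _ ≤ CE * ((1 + Real.log (T / (2 * π))) / T ^ 2) +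
          K * (1 / Real.log c * (Real.log (T / (2 * π)) / T ^ 2 +
            (1 + Real.log (T / (2 * π))) / T ^ 2)) := add_le_add hEv hmBv
    _ ≤ CE * ((1 + Real.log (T / (2 * π))) / T ^ 2) +
          K * (1 / Real.log c * (2 * ((1 + Real.log (T / (2 * π))) / T ^ 2))) := by
        gcongr
        linarith
    _ = (K * (2 / Real.log c) + CE) * ((1 + Real.log (T / (2 * π))) / T ^ 2) := by ring

/-- **[Gr26] Corollary 3.3 (iii), second clause (asymptotic form), PROVED**: for `N ≥ 1`,
`B_T / ((2N+1)ρ/(π²T) · (log(T/2π) + 1)) → 1` as `T → ∞`.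
[cite: Groskin2026, Corollary 3.3 (iii) (p. 11)] -/
theorem tendsto_tailBudget_div {c : ℝ} (hc : 1 < c) {N : ℕ} (hN : 1 ≤ N) :
    Tendsto (fun T : ℝ ↦ tailBudget c N T /
        ((2 * N + 1) * rho c / (π ^ 2 * T) * (Real.log (T / (2 * π)) + 1))) atTop (𝓝 1) := by
  have hρ := rhoPos_aux hc
  have hκ : 0 < 2 * π := by positivity
  obtain ⟨C, hC⟩ := abs_tailBudget_sub_main_le hc hN
  set K : ℝ := (2 * N + 1) * rho c with hK
  have hKpos : 0 < K := by positivity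
  refine tendsto_sub_nhds_zero_iff.1 ?_
  have hlim : Tendsto (fun T : ℝ ↦ C / K / T) atTop (𝓝 0) :=
    (tendsto_const_nhds (x := C / K)).div_atTop tendsto_id
  refine squeeze_zero_norm' ?_ hlim
  filter_upwards [eventually_ge_atTop (max 7 (2 * rho c * N))] with T hT
  have hT7 : 7 ≤ T := (le_max_left _ _).trans hT
  have hTN2 : 2 * rho c * N ≤ T := (le_max_right _ _).trans hT
  have hT0 : 0 < T := by linarith
  have hℓT : 0 ≤ Real.log (T / (2 * π)) :=
    Real.log_nonneg (by rw [le_div_iff₀ hκ]; linarith [two_pi_lt_seven])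
  set m : ℝ := K / (π ^ 2 * T) * (Real.log (T / (2 * π)) + 1) with hm
  have hmpos : 0 < m := by positivity
  have hmain := hC T hT7 hTN2
  -- `π² B_T − K(ℓ+1)/T = π²(B_T − m)`
  have hrew : π ^ 2 * tailBudget c N T - K * ((Real.log (T / (2 * π)) + 1) / T) =
      π ^ 2 * (tailBudget c N T - m) := by
    rw [hm]; field_simp
  rw [hrew, abs_mul, abs_of_pos (by positivity : (0:ℝ) < π ^ 2)] at hmain
  have hdiff : |tailBudget c N T - m| ≤ C * ((1 + Real.log (T / (2 * π))) / T ^ 2) / π ^ 2 := by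
    rw [le_div_iff₀ (by positivity)]; linarith
  rw [Real.norm_eq_abs, show tailBudget c N T / m - 1 = (tailBudget c N T - m) / m from by
    field_simp, abs_div, abs_of_pos hmpos, div_le_iff₀ hmpos]
  refine hdiff.trans (le_of_eq ?_)
  rw [hm]
  field_simp
  ring

/-- **[Gr26] Corollary 3.3 (iii), third clause, PROVED**: "in particular `B_{2T}/B_T → ½`: each
doubling of the archimedean cutoff lowers the certification floor by one binary digit".
[cite: Groskin2026, Corollary 3.3 (iii) (p. 11)] -/
theorem tendsto_tailBudget_two_mul_div {c : ℝ} (hc : 1 < c) {N : ℕ} (hN : 1 ≤ N) :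
    Tendsto (fun T : ℝ ↦ tailBudget c N (2 * T) / tailBudget c N T) atTop (𝓝 (1 / 2)) := by
  have hρ := rhoPos_aux hc
  have hκ : 0 < 2 * π := by positivity
  set K : ℝ := (2 * N + 1) * rho c with hK
  have hKpos : 0 < K := by positivity
  -- the normaliser `m` and the normalised budget `q`
  set m : ℝ → ℝ := fun T ↦ K / (π ^ 2 * T) * (Real.log (T / (2 * π)) + 1) with hm
  set q : ℝ → ℝ := fun T ↦ tailBudget c N T / m T with hq
  have hq1 : Tendsto q atTop (𝓝 1) := tendsto_tailBudget_div hc hN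
  have h2T : Tendsto (fun T : ℝ ↦ 2 * T) atTop atTop := tendsto_id.const_mul_atTop two_pos
  have hq2 : Tendsto (fun T : ℝ ↦ q (2 * T)) atTop (𝓝 1) := hq1.comp h2T
  -- `m(2T)/m(T) = ½ + (log 2/2)/(log(T/2π) + 1) → ½`
  have hℓ : Tendsto (fun T : ℝ ↦ Real.log (T / (2 * π)) + 1) atTop atTop :=
    tendsto_atTop_add_const_right _ 1
      (Real.tendsto_log_atTop.comp (tendsto_id.atTop_div_const hκ))
  have hm' : Tendsto (fun T : ℝ ↦ 1 / 2 + Real.log 2 / 2 / (Real.log (T / (2 * π)) + 1)) atTop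
      (𝓝 (1 / 2)) := by
    have := (tendsto_const_nhds (x := Real.log 2 / 2)).div_atTop hℓ
    simpa using this.const_add (1 / 2 : ℝ)
  have hmratio : Tendsto (fun T : ℝ ↦ m (2 * T) / m T) atTop (𝓝 (1 / 2)) := by
    refine hm'.congr' ?_
    filter_upwards [eventually_ge_atTop 7] with T hT
    have hT0 : 0 < T := by linarith
    have hℓT : 0 ≤ Real.log (T / (2 * π)) :=
      Real.log_nonneg (by rw [le_div_iff₀ hκ]; linarith [two_pi_lt_seven])
    have hlog2T : Real.log (2 * T / (2 * π)) = Real.log 2 + Real.log (T / (2 * π)) := by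
      rw [mul_div_assoc, Real.log_mul two_ne_zero (by positivity)]
    simp only [hm]
    rw [hlog2T]
    field_simp
    ring
  have hprod := hmratio.mul (hq2.div hq1 one_ne_zero)
  rw [div_one, mul_one] at hprod
  refine hprod.congr' ?_
  filter_upwards [eventually_ge_atTop 7] with T hT
  have hT0 : 0 < T := by linarith
  have hℓT : 0 ≤ Real.log (T / (2 * π)) :=
    Real.log_nonneg (by rw [le_div_iff₀ hκ]; linarith [two_pi_lt_seven])
  have hℓ2T : 0 ≤ Real.log (2 * T / (2 * π)) :=
    Real.log_nonneg (by rw [le_div_iff₀ hκ]; linarith [two_pi_lt_seven])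
  have hm1 : m T ≠ 0 := by simp only [hm]; positivity
  have hm2 : m (2 * T) ≠ 0 := by simp only [hm]; positivity
  have e1 : tailBudget c N T = m T * q T := by
    simp only [hq]; rw [mul_div_cancel₀ _ hm1]
  have e2 : tailBudget c N (2 * T) = m (2 * T) * q (2 * T) := by
    simp only [hq]; rw [mul_div_cancel₀ _ hm2]
  simp only [Pi.div_apply]
  rw [e1, e2]
  ring

/-! ### Assembly -/

/-- **[Gr26] Corollary 3.3 (iii) (Explicit budget)**, discharging the claim `corollary_3_3_iii`:
for `N ≥ 1` and `T > max(ρN, 7)`,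
`B_T ≤ (2(2N+1)ρ/π²)(log T/(T − ρN) + (ρN)⁻¹ log(T/(T − ρN)))`; as `T → ∞`,
`B_T = ((2N+1)ρ/(π²T))(log(T/2π) + 1)(1 + o(1))`; and `B_{2T}/B_T → ½`. PROVED, as printed
(`sin² ≤ 1`, the envelope `h₊ ≤ log`, the Cauchy bound, the explicit integral; then the asymptotes of
`h₊` and `‖p_r‖² + ‖q_r‖²`, `sin² = ½ − ½cos(Lr)` and one integration by parts).
[cite: Groskin2026, Corollary 3.3 (iii) (p. 11)] -/
theorem corollary_3_3_iii_holds : Groskin2026.corollary_3_3_iii := fun _c hc _N hN ↦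
  ⟨fun _T hT ↦ tailBudget_le hc hN hT, tendsto_tailBudget_div hc hN,
    tendsto_tailBudget_two_mul_div hc hN⟩

end Groskin2026

end Literature.NumberTheory.LFunctions

end
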